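import Summits.Schanuel.Schanuel.Theorems.ZilberEacFibreMinimalPolynomial
import HarnessLib

/-!
# Arbitrary base branches, CII: THE MINIMAL FIBRE POLYNOMIAL OVER A GENERAL DOMAIN — file XCV with
# the base ring `ℂ[x₀][x₁]` replaced by any `ℂ`-algebra domain `B` and a prime `F ∈ B`

HONEST FRAMING.  Cell `pub-schanuel` (Zilber's Exponential-Algebraic Closedness, case ladder;
host summit Schanuel), seat 2, gen 33.  File XCV produced, for a prime `𝔭` over the curve
`F = 0`, an element of `ℂ[x₀][x₁][y]` of least `y`-degree in `𝔭` that is separable modulo `F` and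
divides `𝔭` modulo `F`.  For the surfaces whose equations involve `y₁` (O90/O91) the same is needed
with base ring `B = ℂ[x₀, x₁, y₁]` and the prime `F` viewed in `B`; this file states and proves
the construction for ANY `ℂ`-algebra domain `B` and prime `F ∈ B`:
**`exists_minimalPolynomial_domain`** (`ι : B[y] → S`, `𝔭 ⊂ S` prime, `ι(F) ∈ 𝔭`,
`ι(G) ∈ 𝔭 ⟹ F ∣ G` on `B`, `ι(y) ∉ 𝔭`, some `P₀` with `ι(P₀) ∈ 𝔭` not `≡ 0 (mod F)` ⟹ a `P`
with `ι(P) ∈ 𝔭`, positive degree, `F ∤ lc`, `F ∤ P(0)`, `F ∤ Res_y(P, ∂P)`, and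
`lc^k G = QP + FH` for every `G` with `ι(G) ∈ 𝔭`), through the abstract function field
`Frac(B/(F))` (**`exists_functionField_of_prime`**).  The proofs are those of file XCV verbatim.
[folklore commutative algebra]; nothing here is specific to Schanuel's conjecture (neither used nor
implied); Mantova–Masser's question (PLMS 2024 §1 p. 5) and EC(3,2) stay OPEN; EAC ⇏ SC.
-/

noncomputable section

open Polynomial

set_option linter.dupNamespace false

namespace Summit.Schanuel.Schanuel.Theorems

section MinimalPolynomialDomain

variable {B : Type} [CommRing B] {F : B} {S : Type*} [CommRing S] {ι : Polynomial B →+* S} {𝔭 : Ideal S}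

/-! ## Part A. Truncation and reduction modulo `F` -/

/-- A polynomial all of whose coefficients are divisible by `F` maps into `𝔭`. [folklore] -/
theorem memD_of_forall_dvd_coeff (hF : ι (Polynomial.C F) ∈ 𝔭) {H : Polynomial B}
    (h : ∀ j, F ∣ H.coeff j) : ι H ∈ 𝔭 := by
  obtain ⟨H₁, rfl⟩ := (Polynomial.C_dvd_iff_dvd_coeff F H).2 h
  rw [map_mul]
  exact 𝔭.mul_mem_right _ hF

/-- **Reduction.**  If `ι(G) ∈ 𝔭`, all coefficients of `G` above `n` are divisible by `F` and
`F ∤ G_n`, then the truncation `Σ_{j ≤ n} G_j y^j` maps into `𝔭`, has degree `n` and top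
coefficient `G_n ∉ (F)`. [folklore] -/
theorem exists_reducedD_of_mem (hF : ι (Polynomial.C F) ∈ 𝔭) {G : Polynomial B} (hG : ι G ∈ 𝔭)
    {n : ℕ} (habove : ∀ j, n < j → F ∣ G.coeff j) (hn : ¬ F ∣ G.coeff n) :
    ∃ G' : Polynomial B, ι G' ∈ 𝔭 ∧ G'.natDegree = n ∧ ¬ F ∣ G'.leadingCoeff ∧
      ∀ j, j ≤ n → G'.coeff j = G.coeff j := by
  classical
  set G' : Polynomial B := ∑ j ∈ Finset.range (n + 1), Polynomial.C (G.coeff j) * Polynomial.X ^ j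
    with hG'
  have hcoeff : ∀ m, G'.coeff m = if m < n + 1 then G.coeff m else 0 := by
    intro m
    rw [hG', Polynomial.finsetSum_coeff]
    simp only [Polynomial.coeff_C_mul_X_pow]
    rw [Finset.sum_ite_eq (Finset.range (n + 1)) m]
    simp only [Finset.mem_range]
  have hGn0 : G.coeff n ≠ 0 := fun h => hn (by rw [h]; exact dvd_zero F)
  have hdeg : G'.natDegree = n := by
    refine le_antisymm ?_ ?_
    · rw [Polynomial.natDegree_le_iff_coeff_eq_zero]
      intro m hm
      rw [hcoeff, if_neg (by omega)]
    · refine Polynomial.le_natDegree_of_ne_zero ?_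
      rw [hcoeff, if_pos (Nat.lt_succ_self n)]
      exact hGn0
  have hdiff : ι (G - G') ∈ 𝔭 := by
    refine memD_of_forall_dvd_coeff hF fun j => ?_
    rw [Polynomial.coeff_sub, hcoeff]
    split_ifs with hj <;> simp only [sub_self, sub_zero, dvd_zero]
    exact habove j (by omega)
  refine ⟨G', ?_, hdeg, ?_, fun j hj => by rw [hcoeff, if_pos (Nat.lt_succ_of_le hj)]⟩
  · have h := 𝔭.sub_mem hG hdiff
    have e : G - (G - G') = G' := by ring
    rwa [← map_sub, e] at h
  · rw [Polynomial.leadingCoeff, hdeg, hcoeff, if_pos (Nat.lt_succ_self n)]; exact hn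

/-- The largest index of a coefficient not divisible by `F`. [folklore] -/
theorem exists_top_not_dvd_coeffD {G : Polynomial B} (hex : ∃ j, ¬ F ∣ G.coeff j) :
    ∃ n, n ≤ G.natDegree ∧ ¬ F ∣ G.coeff n ∧ ∀ j, n < j → F ∣ G.coeff j := by
  classical
  obtain ⟨j₀, hj₀⟩ := hex
  have hj₀le : j₀ ≤ G.natDegree := by
    by_contra h
    exact hj₀ (by rw [Polynomial.coeff_eq_zero_of_natDegree_lt (by omega)]; exact dvd_zero F)
  refine ⟨Nat.findGreatest (fun j => ¬ F ∣ G.coeff j) G.natDegree, Nat.findGreatest_le _,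
    Nat.findGreatest_spec (P := fun j => ¬ F ∣ G.coeff j) hj₀le hj₀, fun j hj => ?_⟩
  by_cases hjd : j ≤ G.natDegree
  · by_contra hdvd
    exact (Nat.lt_irrefl _) (lt_of_lt_of_le hj (Nat.le_findGreatest hjd hdvd))
  · rw [Polynomial.coeff_eq_zero_of_natDegree_lt (by omega)]
    exact dvd_zero F

/-! ## Part B. Minimality: divisibility of coefficients and division modulo `F` -/

/-- **Minimality forces divisibility of all coefficients** below the least reduced degree `d`.
[folklore] -/
theorem forall_dvd_coeffD_of_natDegree_lt (hF : ι (Polynomial.C F) ∈ 𝔭) {d : ℕ}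
    (hmin : ∀ G, ι G ∈ 𝔭 → ¬ F ∣ G.leadingCoeff → d ≤ G.natDegree) {G : Polynomial B}
    (hG : ι G ∈ 𝔭) (hlt : G.natDegree < d) : ∀ j, F ∣ G.coeff j := by
  by_contra h
  push Not at h
  obtain ⟨n, hnle, hn, habove⟩ := exists_top_not_dvd_coeffD h
  obtain ⟨G', hG'mem, hG'deg, hG'lc, -⟩ := exists_reducedD_of_mem hF hG habove hn
  have := hmin G' hG'mem hG'lc
  omega

/-- **Division modulo `F`**: with `ι(P) ∈ 𝔭`, `P` of the least reduced degree, every `G` with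
`ι(G) ∈ 𝔭` satisfies `lc(P)^k G = Q P + H` with all coefficients of `H` divisible by `F`.
[folklore] -/
theorem exists_divisionD_mod (hF : ι (Polynomial.C F) ∈ 𝔭) {P : Polynomial B} (hP : ι P ∈ 𝔭)
    (hmin : ∀ G, ι G ∈ 𝔭 → ¬ F ∣ G.leadingCoeff → P.natDegree ≤ G.natDegree) :
    ∀ (n : ℕ) (G : Polynomial B), ι G ∈ 𝔭 → G.natDegree ≤ n →
      ∃ (k : ℕ) (Q H : Polynomial B), Polynomial.C P.leadingCoeff ^ k * G = Q * P + H ∧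
        ∀ j, F ∣ H.coeff j := by
  intro n
  induction n using Nat.strong_induction_on with
  | _ n ih =>
  intro G hG hGn
  by_cases hlt : G.natDegree < P.natDegree
  · exact ⟨0, 0, G, by simp, forall_dvd_coeffD_of_natDegree_lt hF hmin hG hlt⟩
  · push Not at hlt
    -- cancel the top term
    set G₁ : Polynomial B := Polynomial.C P.leadingCoeff * G -
      Polynomial.C G.leadingCoeff * Polynomial.X ^ (G.natDegree - P.natDegree) * P with hG₁
    have hG₁mem : ι G₁ ∈ 𝔭 := by
      have h1 : ι (Polynomial.C P.leadingCoeff * G) -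
          ι (Polynomial.C G.leadingCoeff * Polynomial.X ^ (G.natDegree - P.natDegree) * P) ∈ 𝔭 := by
        refine 𝔭.sub_mem ?_ ?_
        · rw [map_mul]; exact 𝔭.mul_mem_left _ hG
        · rw [map_mul]; exact 𝔭.mul_mem_left _ hP
      rwa [← map_sub, ← hG₁] at h1
    have hle : G₁.natDegree ≤ G.natDegree := by
      rw [hG₁]
      refine (Polynomial.natDegree_sub_le _ _).trans (max_le (Polynomial.natDegree_C_mul_le _ _) ?_)
      refine Polynomial.natDegree_mul_le.trans ?_
      refine (add_le_add (Polynomial.natDegree_C_mul_X_pow_le _ _) le_rfl).trans ?_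
      omega
    have hcoef : G₁.coeff G.natDegree = 0 := by
      rw [hG₁, Polynomial.coeff_sub, Polynomial.coeff_C_mul, mul_assoc, Polynomial.coeff_C_mul,
        Polynomial.coeff_X_pow_mul', if_pos (Nat.sub_le _ _)]
      have e : P.coeff (G.natDegree - (G.natDegree - P.natDegree)) = P.leadingCoeff := by
        rw [Polynomial.leadingCoeff]; congr 1; omega
      rw [e, Polynomial.leadingCoeff, Polynomial.leadingCoeff]
      ring
    have hG₁deg : G₁.natDegree < G.natDegree ∨ G₁ = 0 := by
      by_cases h0 : G₁ = 0
      · exact Or.inr h0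
      · refine Or.inl (lt_of_le_of_ne hle fun heq => h0 ?_)
        exact Polynomial.leadingCoeff_eq_zero.1 (by rw [Polynomial.leadingCoeff, heq, hcoef])
    -- recurse
    have hrec : ∃ (k : ℕ) (Q H : Polynomial B),
        Polynomial.C P.leadingCoeff ^ k * G₁ = Q * P + H ∧ ∀ j, F ∣ H.coeff j := by
      rcases hG₁deg with hlt' | h0
      · exact ih (G.natDegree - 1) (by omega) G₁ hG₁mem (by omega)
      · exact ⟨0, 0, 0, by rw [h0]; simp, fun j => by simp⟩
    obtain ⟨k, Q, H, hQH, hH⟩ := hrec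
    refine ⟨k + 1, Q + Polynomial.C P.leadingCoeff ^ k * (Polynomial.C G.leadingCoeff *
      Polynomial.X ^ (G.natDegree - P.natDegree)), H, ?_, hH⟩
    have e1 : Polynomial.C P.leadingCoeff ^ (k + 1) * G =
        Polynomial.C P.leadingCoeff ^ k * G₁ + Polynomial.C P.leadingCoeff ^ k *
          (Polynomial.C G.leadingCoeff * Polynomial.X ^ (G.natDegree - P.natDegree)) * P := by
      rw [hG₁]; ring
    rw [e1, hQH]; ring

/-! ## Part C. The function field of the curve and separability -/

/-- **The function field of an irreducible plane curve**, abstractly: a field `K` of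
characteristic zero with a homomorphism `φ : ℂ[x₀][x₁] → K` whose kernel is `(F)` and whose image
generates `K` as a field of fractions (`K = Frac(ℂ[x₀][x₁]/(F))`). [folklore] -/
theorem exists_functionField_of_prime [IsDomain B] [Algebra ℂ B] (hprime : Prime F) :
    ∃ (K : Type) (_ : Field K) (_ : CharZero K) (φ : B →+* K),
      (∀ G : B, φ G = 0 ↔ F ∣ G) ∧
      (∀ z : K, ∃ a b : B, φ b ≠ 0 ∧ z * φ b = φ a) := by
  classical
  haveI hIp : (Ideal.span {F} : Ideal B).IsPrime :=
    (Ideal.span_singleton_prime hprime.ne_zero).2 hprime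
  haveI : IsDomain (B ⧸ (Ideal.span {F} : Ideal B)) := Ideal.Quotient.isDomain _
  have hinjC : Function.Injective (algebraMap ℂ (B ⧸ (Ideal.span {F} : Ideal B))) :=
    (algebraMap ℂ _).injective
  haveI : CharZero (B ⧸ (Ideal.span {F} : Ideal B)) := charZero_of_injective_algebraMap hinjC
  have hinjAK : Function.Injective (algebraMap (B ⧸ (Ideal.span {F} : Ideal B))
      (FractionRing (B ⧸ (Ideal.span {F} : Ideal B)))) := IsFractionRing.injective _ _
  haveI : CharZero (FractionRing (B ⧸ (Ideal.span {F} : Ideal B))) :=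
    charZero_of_injective_algebraMap hinjAK
  have htower : ∀ G : B, algebraMap B (FractionRing (B ⧸ (Ideal.span {F} : Ideal B))) G =
      (algebraMap (B ⧸ (Ideal.span {F} : Ideal B)) (FractionRing (B ⧸ (Ideal.span {F} : Ideal B))))
        (algebraMap B (B ⧸ (Ideal.span {F} : Ideal B)) G) :=
    fun G => IsScalarTower.algebraMap_apply _ _ _ G
  refine ⟨FractionRing (B ⧸ (Ideal.span {F} : Ideal B)), inferInstance, inferInstance,
    algebraMap B _, fun G => ?_, fun z => ?_⟩
  · rw [htower]
    constructor
    · intro h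
      have h1 : algebraMap B (B ⧸ (Ideal.span {F} : Ideal B)) G = 0 :=
        hinjAK (by rw [map_zero]; exact h)
      rw [Ideal.Quotient.algebraMap_eq, Ideal.Quotient.eq_zero_iff_mem, Ideal.mem_span_singleton] at h1
      exact h1
    · intro h
      have h1 : Ideal.Quotient.mk (Ideal.span {F} : Ideal B) G = 0 := by
        rw [Ideal.Quotient.eq_zero_iff_mem, Ideal.mem_span_singleton]; exact h
      rw [Ideal.Quotient.algebraMap_eq, h1, map_zero]
  · obtain ⟨a, b, hb, hab⟩ := IsFractionRing.div_surjective (A := B ⧸ (Ideal.span {F} : Ideal B)) z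
    obtain ⟨a', ha'⟩ := Ideal.Quotient.mk_surjective a
    obtain ⟨b', hb'⟩ := Ideal.Quotient.mk_surjective b
    have hb0 : algebraMap (B ⧸ (Ideal.span {F} : Ideal B))
        (FractionRing (B ⧸ (Ideal.span {F} : Ideal B))) b ≠ 0 :=
      fun h => nonZeroDivisors.ne_zero hb (hinjAK (by rw [map_zero]; exact h))
    refine ⟨a', b', ?_, ?_⟩
    · rw [htower, Ideal.Quotient.algebraMap_eq, hb']
      exact hb0
    · rw [htower, htower, Ideal.Quotient.algebraMap_eq, ha', hb', ← hab]
      field_simp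

/-- **Clearing denominators** of a polynomial over the function field. [folklore] -/
theorem exists_clear_denominatorsD {K : Type*} [Field K] (φ : B →+* K)
    (hfrac : ∀ z : K, ∃ a b : B, φ b ≠ 0 ∧ z * φ b = φ a) (p : K[X]) :
    ∃ (c : B) (p₂ : Polynomial B), φ c ≠ 0 ∧ p₂.map φ = Polynomial.C (φ c) * p := by
  induction p using Polynomial.induction_on' with
  | add p q hp hq =>
    obtain ⟨c₁, p₁, hc₁, hp₁⟩ := hp
    obtain ⟨c₂, q₁, hc₂, hq₁⟩ := hq
    refine ⟨c₁ * c₂, Polynomial.C c₂ * p₁ + Polynomial.C c₁ * q₁, ?_, ?_⟩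
    · rw [map_mul]; exact mul_ne_zero hc₁ hc₂
    · rw [Polynomial.map_add, Polynomial.map_mul, Polynomial.map_mul, Polynomial.map_C,
        Polynomial.map_C, hp₁, hq₁, map_mul, map_mul]
      ring
  | monomial n z =>
    obtain ⟨a, b, hb, hab⟩ := hfrac z
    refine ⟨b, Polynomial.monomial n a, hb, ?_⟩
    rw [Polynomial.map_monomial, ← hab, Polynomial.C_mul_monomial, mul_comm]

/-- **Separability of the minimal reduced element.**  With `ι(P) ∈ 𝔭`, `P` of positive degree,
`F ∤ lc(P)`, of the least reduced degree (`F` irreducible, `ι(F) ∈ 𝔭`, `𝔭` prime): the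
`y`-discriminant `Res_y(P, ∂_yP)` is not divisible by `F` — `P` is irreducible, hence separable,
over the function field. [folklore] -/
theorem not_dvd_resultantD_of_minimal [IsDomain B] [Algebra ℂ B] (hprime : Prime F) [h𝔭 : 𝔭.IsPrime]
    (hF : ι (Polynomial.C F) ∈ 𝔭) {P : Polynomial B} (hP : ι P ∈ 𝔭) (hd : 1 ≤ P.natDegree)
    (hlc : ¬ F ∣ P.leadingCoeff)
    (hmin : ∀ G, ι G ∈ 𝔭 → ¬ F ∣ G.leadingCoeff → P.natDegree ≤ G.natDegree) :
    ¬ F ∣ Polynomial.resultant P (derivative P) P.natDegree (P.natDegree - 1) := by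
  classical
  obtain ⟨K, instK, instCZ, φ, hφ0, hfrac⟩ := exists_functionField_of_prime hprime
  have hmapφ0 : ∀ G : Polynomial B, G.map φ = 0 ↔ ∀ j, F ∣ G.coeff j := by
    intro G
    rw [Polynomial.ext_iff]
    refine forall_congr' fun j => ?_
    rw [Polynomial.coeff_map, Polynomial.coeff_zero, hφ0]
  -- the image `P̄` of `P`
  set d := P.natDegree with hdP
  set Pb : K[X] := P.map φ with hPb
  have hlcφ : φ P.leadingCoeff ≠ 0 := fun h => hlc ((hφ0 _).1 h)
  have hPbdeg : Pb.natDegree = d := Polynomial.natDegree_map_of_leadingCoeff_ne_zero φ hlcφ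
  have hPb0 : Pb ≠ 0 := fun h => by
    have := congrArg Polynomial.natDegree h; rw [hPbdeg, Polynomial.natDegree_zero] at this; omega
  have hPbnu : ¬ IsUnit Pb := fun hu => by
    have := Polynomial.natDegree_eq_zero_of_isUnit hu; omega
  -- a lift to `ℂ[x₀][x₁][y]` of a constant multiple of a factor of small degree contradicts minimality
  have key : ∀ (g₂ : Polynomial B) (g : K[X]) (cg : B), φ cg ≠ 0 →
      g₂.map φ = Polynomial.C (φ cg) * g → 0 < g.natDegree → g.natDegree < d →
      ι g₂ ∈ 𝔭 → False := by
    intro g₂ g cg hcg hg₂ hgpos hglt hg₂mem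
    have hgdeg : (g₂.map φ).natDegree = g.natDegree := by
      rw [hg₂, Polynomial.natDegree_C_mul hcg]
    have habove : ∀ j, g.natDegree < j → F ∣ g₂.coeff j := by
      intro j hj
      rw [← hφ0, ← Polynomial.coeff_map]
      exact Polynomial.coeff_eq_zero_of_natDegree_lt (by rw [hgdeg]; exact hj)
    have htop : ¬ F ∣ g₂.coeff g.natDegree := by
      rw [← hφ0, ← Polynomial.coeff_map, ← hgdeg, ← Polynomial.leadingCoeff]
      intro h
      have h0 : g₂.map φ = 0 := Polynomial.leadingCoeff_eq_zero.1 h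
      rw [h0, Polynomial.natDegree_zero] at hgdeg
      omega
    obtain ⟨G', hG'mem, hG'deg, hG'lc, -⟩ := exists_reducedD_of_mem hF hg₂mem habove htop
    have := hmin G' hG'mem hG'lc
    omega
  -- `P̄` is irreducible by minimality
  have hirr : Irreducible Pb := by
    by_contra hnot
    obtain ⟨a, b, ha, hb, hab⟩ : ∃ a b : K[X], ¬ IsUnit a ∧ ¬ IsUnit b ∧ a * b = Pb := by
      rcases irreducible_or_factor hPbnu with h | ⟨a, b, ha, hb, h⟩
      · exact (hnot h).elim
      · exact ⟨a, b, ha, hb, h.symm⟩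
    have ha0 : a ≠ 0 := by rintro rfl; exact hPb0 (by rw [← hab, zero_mul])
    have hb0 : b ≠ 0 := by rintro rfl; exact hPb0 (by rw [← hab, mul_zero])
    have hadeg := Polynomial.natDegree_pos_iff_degree_pos.2 (Polynomial.degree_pos_of_ne_zero_of_nonunit ha0 ha)
    have hbdeg := Polynomial.natDegree_pos_iff_degree_pos.2 (Polynomial.degree_pos_of_ne_zero_of_nonunit hb0 hb)
    have hsum : a.natDegree + b.natDegree = d := by
      rw [← Polynomial.natDegree_mul ha0 hb0, hab, hPbdeg]
    obtain ⟨ca, a₂, hca, ha₂⟩ := exists_clear_denominatorsD φ hfrac a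
    obtain ⟨cb, b₂, hcb, hb₂⟩ := exists_clear_denominatorsD φ hfrac b
    -- `a₂ b₂ - (ca cb) P` has all coefficients divisible by `F`, so `ι(a₂ b₂) ∈ 𝔭`
    have hdiff : ∀ j, F ∣ (a₂ * b₂ - Polynomial.C (ca * cb) * P).coeff j := by
      rw [← hmapφ0, Polynomial.map_sub, Polynomial.map_mul, Polynomial.map_mul, Polynomial.map_C,
        ha₂, hb₂, map_mul, ← hPb, ← hab, map_mul]
      ring
    have hab₂ : ι (a₂ * b₂) ∈ 𝔭 := by
      have h1 := memD_of_forall_dvd_coeff hF hdiff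
      have h2 := 𝔭.add_mem h1 (𝔭.mul_mem_left (ι (Polynomial.C (ca * cb))) hP)
      rw [← map_mul, ← map_add] at h2
      have e : a₂ * b₂ - Polynomial.C (ca * cb) * P + Polynomial.C (ca * cb) * P = a₂ * b₂ := by ring
      rwa [e] at h2
    rw [map_mul] at hab₂
    rcases h𝔭.mem_or_mem hab₂ with h | h
    · exact key a₂ a ca hca ha₂ hadeg (by omega) h
    · exact key b₂ b cb hcb hb₂ hbdeg (by omega) h
  -- irreducible ⟹ separable ⟹ the resultant with the derivative is nonzero in `K`
  have hsep : Pb.Separable := hirr.separable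
  have hres : Polynomial.resultant Pb (derivative Pb) ≠ 0 := Polynomial.resultant_ne_zero _ _ hsep
  have hdegs : (derivative Pb).natDegree = d - 1 := by
    rw [natDegree_derivative_eq_sub_one (by rw [hPbdeg]; exact hd), hPbdeg]
  intro hdvd
  apply hres
  rw [← (hφ0 _).2 hdvd, ← Polynomial.resultant_map_map, ← Polynomial.derivative_map, ← hPb, ← hdegs,
    ← hPbdeg]

/-! ## Part D. The theorem -/

/-- **The minimal fibre polynomial.**  See the module docstring. [folklore commutative algebra]
(new in this form) -/
theorem exists_minimalPolynomial_domain [IsDomain B] [Algebra ℂ B] (hprime : Prime F) [h𝔭 : 𝔭.IsPrime]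
    (hF : ι (Polynomial.C F) ∈ 𝔭) (hconst : ∀ G : B, ι (Polynomial.C G) ∈ 𝔭 → F ∣ G)
    (hX : ι Polynomial.X ∉ 𝔭) {P₀ : Polynomial B} (hP₀ : ι P₀ ∈ 𝔭)
    (hP₀nd : ∃ j, ¬ F ∣ P₀.coeff j) :
    ∃ P : Polynomial B, ι P ∈ 𝔭 ∧ 1 ≤ P.natDegree ∧ ¬ F ∣ P.leadingCoeff ∧ ¬ F ∣ P.coeff 0 ∧
      ¬ F ∣ Polynomial.resultant P (derivative P) P.natDegree (P.natDegree - 1) ∧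
      ∀ G, ι G ∈ 𝔭 → ∃ (k : ℕ) (Q H : Polynomial B),
        Polynomial.C P.leadingCoeff ^ k * G = Q * P + H ∧ ∀ j, F ∣ H.coeff j := by
  classical
  -- a reduced element exists
  have hex : ∃ n, ∃ G : Polynomial B, ι G ∈ 𝔭 ∧ G.natDegree = n ∧ ¬ F ∣ G.leadingCoeff := by
    obtain ⟨n, -, hn, habove⟩ := exists_top_not_dvd_coeffD hP₀nd
    obtain ⟨G', hG'mem, hG'deg, hG'lc, -⟩ := exists_reducedD_of_mem hF hP₀ habove hn; exact ⟨n, G', hG'mem, hG'deg, hG'lc⟩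
  obtain ⟨P, hP, hPdeg, hPlc⟩ := Nat.find_spec hex
  have hmin : ∀ G, ι G ∈ 𝔭 → ¬ F ∣ G.leadingCoeff → P.natDegree ≤ G.natDegree := by
    intro G hG hGlc
    rw [hPdeg]
    exact Nat.find_min' hex ⟨G, hG, rfl, hGlc⟩
  -- positive degree
  have hd : 1 ≤ P.natDegree := by
    by_contra h0
    have h00 : P.natDegree = 0 := by omega
    have hPC : P = Polynomial.C (P.coeff 0) := Polynomial.eq_C_of_natDegree_eq_zero h00
    apply hPlc
    rw [Polynomial.leadingCoeff, h00]
    exact hconst _ (by rw [← hPC]; exact hP)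
  refine ⟨P, hP, hd, hPlc, ?_, not_dvd_resultantD_of_minimal hprime hF hP hd hPlc hmin, ?_⟩
  · -- the constant coefficient: `P = divX(P)·y + P₀`; `F ∣ P₀` would put `divX(P)·y` in `𝔭`
    intro h0
    obtain ⟨h, hh⟩ := h0
    have hsplit : P.divX * Polynomial.X = P - Polynomial.C F * Polynomial.C h := by
      rw [← map_mul, ← hh]
      have e := Polynomial.divX_mul_X_add P
      calc P.divX * Polynomial.X = P.divX * Polynomial.X + Polynomial.C (P.coeff 0) -
          Polynomial.C (P.coeff 0) := by ring
        _ = P - Polynomial.C (P.coeff 0) := by rw [e]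
    have hmem : ι (P.divX * Polynomial.X) ∈ 𝔭 := by
      have h1 : ι P - ι (Polynomial.C F * Polynomial.C h) ∈ 𝔭 :=
        𝔭.sub_mem hP (by rw [map_mul]; exact 𝔭.mul_mem_right _ hF)
      rwa [← map_sub, ← hsplit] at h1
    rw [map_mul] at hmem
    rcases h𝔭.mem_or_mem hmem with h1 | h1
    · have hdeg1 : P.divX.natDegree = P.natDegree - 1 := Polynomial.natDegree_divX_eq_natDegree_tsub_one
      have hlc1 : P.divX.leadingCoeff = P.leadingCoeff := by
        rw [Polynomial.leadingCoeff, Polynomial.leadingCoeff, hdeg1, Polynomial.coeff_divX,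
          Nat.sub_add_cancel hd]
      have := hmin _ h1 (by rw [hlc1]; exact hPlc)
      omega
    · exact hX h1
  · intro G hG
    exact exists_divisionD_mod hF hP hmin G.natDegree G hG le_rfl

end MinimalPolynomialDomain

end Summit.Schanuel.Schanuel.Theorems
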